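import Literature.AlgebraicGeometry.HodgeTheory.ComplexTorusIntegralHodgeClassesKunnethProjectors
import Literature.AlgebraicGeometry.HodgeTheory.ComplexTorusIntegralHodgeClassesCorrespondenceExteriorProduct
import HarnessLib

/-!
# The transpose of an exterior product of correspondences: `(α × β)′ = α′ × β′`, and `ᵗ(π_{s,X} × π_{t,X′}) = π_{2g−s,X} × π_{2g′−t,X′}`

Sequel of g27-#6/g28 (`ComplexTorusIntegralHodgeClassesCorrespondenceTranspose`: Fulton's transpose `α′ = τ_*α` along `τ : X × Y → Y × X`, "= Lange's `ᵗZ := s^*Z`")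
and g29-#4 (`…CorrespondenceExteriorProduct`: the exterior product `α × β = q_{XY}^*α · q_{X′Y′}^*β : X × X′ ⊢ Y × Y′`, the tensor product of morphisms of Fulton's
tensor category of correspondences, Example 16.1.12). The tensor product commutes with transposition:

* §1 **`integralHodgeClassesPushforward_swapHom_corrCross`** — **`(α × β)′ = α′ × β′`** for `α ∈ Hdgᵃ(X × Y, ℤ)`, `β ∈ Hdg^{a′}(X′ × Y′, ℤ)`: the transpose of
  `α × β` along `τ : (X × X′) × (Y × Y′) → (Y × Y′) × (X × X′)` is the exterior product on `(Y × Y′) × (X × X′)` of the transposes (`τ_* = (τ⁻¹)^*`, g27-#3, `^*` a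
  ring map, and `τ⁻¹ ≫ q_{XY} = q_{YX} ≫ τ_{YX}`, §0);
* §2 **`integralHodgeClassesPushforward_swapHom_kunnethProjectorCross`** — **`ᵗ(π_{s,X} × π_{t,X′}) = π_{2g_X−s,X} × π_{2g_{X′}−t,X′}`** for the Künneth projectors
  (`ᵗπ_i = π_{2g−i}`, Prop. 6.3.10, g29-#5, on each factor): the transpose of the `(s, t)`-piece of `Hdg((X × X′) × (X × X′), ℤ)` (g29-#11, g30-#3) is the
  `(2g_X − s, 2g_{X′} − t)`-piece, refining `ᵗπ_{n,X×X′} = π_{2(g_X+g_{X′})−n,X×X′}`.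

Everything is a theorem; no definition, no named fact (D-0026). Frames arbitrary; the transpose is g27-#6's `integralHodgeClassesPushforward r r (swapHom _ _) e e′ …`.

## References
* [Fulton1998] W. Fulton, Intersection Theory, 2nd ed., Springer 1998, §16.1 (p0293 L12–L16: "`α′ = τ_*(α)`"), Prop. 16.1.1 (b) (p0293 L23), Example 16.1.12
  (p0300 L9–L12, p0301 L9).
* [Lange2023AbelianVarietiesComplex] H. Lange, Abelian Varieties over the Complex Numbers, Springer 2023, §6.2.2 (p0304 L11–L13: "`Z ↦ ᵗZ := s^*Z`"), §6.3.4
  Prop. 6.3.10 (p0318 L48 – p0319 L7).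
-/

noncomputable section

open CategoryTheory Function

namespace Literature.AlgebraicGeometry.HodgeTheory

open Literature.AlgebraicGeometry.Motives Literature.AlgebraicGeometry.Motives.HodgeStructure
open Literature.Geometry.Kaehler Literature.Geometry.Kaehler.ComplexTorus

namespace ComplexTorusCat

/-! ## §0 The exchange of `(A × A′) × (B × B′)` against the projections `q` -/

section Plumbing

variable (A A' B B' : ComplexTorusCat)

/-- `τ_{(B×B′)(A×A′)} ≫ q_{AB} = q_{BA} ≫ τ_{BA} : (B × B′) × (A × A′) → A × B` (`((b, b′), (a, a′)) ↦ (a, b)`). [cite: Fulton1998, §16.1 (p0293 L12–L16)]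
[cite: Lange2023AbelianVarietiesComplex, §1.1.2 (p0021 L5)] -/
theorem swapHom_comp_liftHom_fst_fst_snd_fst :
    swapHom (prodObj B B') (prodObj A A') ≫ liftHom (fstHom (prodObj A A') (prodObj B B') ≫ fstHom A A') (sndHom (prodObj A A') (prodObj B B') ≫ fstHom B B') =
      liftHom (fstHom (prodObj B B') (prodObj A A') ≫ fstHom B B') (sndHom (prodObj B B') (prodObj A A') ≫ fstHom A A') ≫ swapHom B A := by
  refine prod_hom_ext ?_ ?_ <;>
    simp only [swapHom_def, Category.assoc, liftHom_fstHom, liftHom_sndHom, liftHom_fstHom_assoc, liftHom_sndHom_assoc]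

/-- `τ_{(B×B′)(A×A′)} ≫ q_{A′B′} = q_{B′A′} ≫ τ_{B′A′} : (B × B′) × (A × A′) → A′ × B′`. [cite: Fulton1998, §16.1 (p0293 L12–L16)] [cite: Lange2023AbelianVarietiesComplex, §1.1.2 (p0021 L5)] -/
theorem swapHom_comp_liftHom_fst_snd_snd_snd :
    swapHom (prodObj B B') (prodObj A A') ≫ liftHom (fstHom (prodObj A A') (prodObj B B') ≫ sndHom A A') (sndHom (prodObj A A') (prodObj B B') ≫ sndHom B B') =
      liftHom (fstHom (prodObj B B') (prodObj A A') ≫ sndHom B B') (sndHom (prodObj B B') (prodObj A A') ≫ sndHom A A') ≫ swapHom B' A' := by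
  refine prod_hom_ext ?_ ?_ <;>
    simp only [swapHom_def, Category.assoc, liftHom_fstHom, liftHom_sndHom, liftHom_fstHom_assoc, liftHom_sndHom_assoc]

end Plumbing

/-! ## §1 `(α × β)′ = α′ × β′` -/

section Transpose

variable {X X' Y Y' : ComplexTorusCat} {nXY nX'Y' nP gXY gX'Y' GP : ℕ} (eXY : Fin nXY ≃ (prodObj X Y).toIsog.ι) (eYX : Fin nXY ≃ (prodObj Y X).toIsog.ι)
  (eX'Y' : Fin nX'Y' ≃ (prodObj X' Y').toIsog.ι) (eY'X' : Fin nX'Y' ≃ (prodObj Y' X').toIsog.ι) (eP : Fin nP ≃ (prodObj (prodObj X X') (prodObj Y Y')).toIsog.ι)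
  (eP' : Fin nP ≃ (prodObj (prodObj Y Y') (prodObj X X')).toIsog.ι) {a a' A lX lZ L : ℕ} (haa' : a + a' = A) (hs : lX + 2 * a = nXY) (hgXY : gXY + gXY = nXY)
  (hs' : lZ + 2 * a' = nX'Y') (hgX'Y' : gX'Y' + gX'Y' = nX'Y') (hC : L + 2 * A = nP) (hGP : GP + GP = nP)

/-- **`(α × β)′ = α′ × β′`** for correspondences `α ∈ Hdgᵃ(X × Y, ℤ)`, `β ∈ Hdg^{a′}(X′ × Y′, ℤ)`: the transpose (Fulton `α′ = τ_*α`, Lange `ᵗZ = s^*Z`) of the exterior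
product `α × β = q_{XY}^*α · q_{X′Y′}^*β` along the exchange `τ : (X × X′) × (Y × Y′) → (Y × Y′) × (X × X′)` is the exterior product `α′ × β′ = q_{YX}^*α′ ·
q_{Y′X′}^*β′` of the transposes — the tensor product of Example 16.1.12 commutes with transposition. Proof: `τ_* = (τ⁻¹)^*` (g27-#3/#6
`integralHodgeClassesPushforward_swapHom`), `^*` is a ring homomorphism, and `τ⁻¹ ≫ q_{XY} = q_{YX} ≫ τ_{YX}` (§0).
[cite: Fulton1998, §16.1 (p0293 L12–L16) and Example 16.1.12 (p0300 L9–L12, p0301 L9)] [cite: Lange2023AbelianVarietiesComplex, §6.2.2 (p0304 L11–L13)] -/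
theorem integralHodgeClassesPushforward_swapHom_corrCross (α : integralHodgeClasses (prodObj X Y).toIsog.Φ a) (β : integralHodgeClasses (prodObj X' Y').toIsog.Φ a') :
    integralHodgeClassesPushforward A A (swapHom (prodObj X X') (prodObj Y Y')) eP eP' hC hGP hC hGP
        (integralHodgeClassesCup (prodObj (prodObj X X') (prodObj Y Y')).toIsog.Φ haa'
          (integralHodgeClassesPullbackHom
            (liftHom (fstHom (prodObj X X') (prodObj Y Y') ≫ fstHom X X') (sndHom (prodObj X X') (prodObj Y Y') ≫ fstHom Y Y')) a α)
          (integralHodgeClassesPullbackHom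
            (liftHom (fstHom (prodObj X X') (prodObj Y Y') ≫ sndHom X X') (sndHom (prodObj X X') (prodObj Y Y') ≫ sndHom Y Y')) a' β)) =
      integralHodgeClassesCup (prodObj (prodObj Y Y') (prodObj X X')).toIsog.Φ haa'
        (integralHodgeClassesPullbackHom
          (liftHom (fstHom (prodObj Y Y') (prodObj X X') ≫ fstHom Y Y') (sndHom (prodObj Y Y') (prodObj X X') ≫ fstHom X X')) a
          (integralHodgeClassesPushforward a a (swapHom X Y) eXY eYX hs hgXY hs hgXY α))
        (integralHodgeClassesPullbackHom
          (liftHom (fstHom (prodObj Y Y') (prodObj X X') ≫ sndHom Y Y') (sndHom (prodObj Y Y') (prodObj X X') ≫ sndHom X X')) a'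
          (integralHodgeClassesPushforward a' a' (swapHom X' Y') eX'Y' eY'X' hs' hgX'Y' hs' hgX'Y' β)) := by
  rw [integralHodgeClassesPushforward_swapHom, integralHodgeClassesPushforward_swapHom, integralHodgeClassesPushforward_swapHom, integralHodgeClassesPullbackHom_cup,
    ← integralHodgeClassesPullbackHom_comp, ← integralHodgeClassesPullbackHom_comp, ← integralHodgeClassesPullbackHom_comp, ← integralHodgeClassesPullbackHom_comp,
    swapHom_comp_liftHom_fst_fst_snd_fst, swapHom_comp_liftHom_fst_snd_snd_snd]

end Transpose

/-! ## §2 `ᵗ(π_{s,X} × π_{t,X′}) = π_{2g_X−s,X} × π_{2g_{X′}−t,X′}` -/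

section Kunneth

variable (X X' : ComplexTorusCat) {gX gX' gXX gX'X' G GP : ℕ} (hG : gX + gX' = G) (eX : Fin (2 * gX) ≃ X.toIsog.ι) (eXX : Fin (2 * gXX) ≃ (prodObj X X).toIsog.ι)
  (hX0 : 2 * gX + 2 * 0 = 2 * gX) (hgX : gX + gX = 2 * gX) (hcX : 2 * gX + 2 * gX = 2 * gXX) (hgXX : gXX + gXX = 2 * gXX)
  (eX' : Fin (2 * gX') ≃ X'.toIsog.ι) (eX'X' : Fin (2 * gX'X') ≃ (prodObj X' X').toIsog.ι)
  (hX'0 : 2 * gX' + 2 * 0 = 2 * gX') (hgX' : gX' + gX' = 2 * gX') (hcX' : 2 * gX' + 2 * gX' = 2 * gX'X') (hgX'X' : gX'X' + gX'X' = 2 * gX'X')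
  (ePP : Fin (2 * GP) ≃ (prodObj (prodObj X X') (prodObj X X')).toIsog.ι) (hcP : 2 * G + 2 * G = 2 * GP) (hgPP : GP + GP = 2 * GP)

/-- **`ᵗ(π_{s,X} × π_{t,X′}) = π_{s₂,X} × π_{t₂,X′}` with `s + s₂ = 2g_X`, `t + t₂ = 2g_{X′}`**: the transpose along the exchange of the two factors `X × X′` of
`(X × X′) × (X × X′)` of the `(s, t)`-piece `π_{s,X} × π_{t,X′}` (g29-#11/g30-#3) is the `(2g_X − s, 2g_{X′} − t)`-piece — §1 and Prop. 6.3.10 `ᵗπ_i = π_{2g−i}` on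
each factor (g29-#5 `integralHodgeClassesPushforward_swapHom_kunnethProjector`). [cite: Lange2023AbelianVarietiesComplex, §6.3.4 Prop. 6.3.10 (p0318 L48 – p0319 L7)]
[cite: Fulton1998, §16.1 Example 16.1.12 (p0301 L9)] -/
theorem integralHodgeClassesPushforward_swapHom_kunnethProjectorCross (s t s₂ t₂ : ℕ) (hss : s + s₂ = 2 * gX) (htt : t + t₂ = 2 * gX') :
    integralHodgeClassesPushforward G G (swapHom (prodObj X X') (prodObj X X')) ePP ePP hcP hgPP hcP hgPP
        (integralHodgeClassesCup (prodObj (prodObj X X') (prodObj X X')).toIsog.Φ hG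
          (integralHodgeClassesPullbackHom
            (liftHom (fstHom (prodObj X X') (prodObj X X') ≫ fstHom X X') (sndHom (prodObj X X') (prodObj X X') ≫ fstHom X X')) gX
            (kunnethProjector X eX eXX hX0 hgX hcX hgXX s))
          (integralHodgeClassesPullbackHom
            (liftHom (fstHom (prodObj X X') (prodObj X X') ≫ sndHom X X') (sndHom (prodObj X X') (prodObj X X') ≫ sndHom X X')) gX'
            (kunnethProjector X' eX' eX'X' hX'0 hgX' hcX' hgX'X' t))) =
      integralHodgeClassesCup (prodObj (prodObj X X') (prodObj X X')).toIsog.Φ hG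
        (integralHodgeClassesPullbackHom
          (liftHom (fstHom (prodObj X X') (prodObj X X') ≫ fstHom X X') (sndHom (prodObj X X') (prodObj X X') ≫ fstHom X X')) gX
          (kunnethProjector X eX eXX hX0 hgX hcX hgXX s₂))
        (integralHodgeClassesPullbackHom
          (liftHom (fstHom (prodObj X X') (prodObj X X') ≫ sndHom X X') (sndHom (prodObj X X') (prodObj X X') ≫ sndHom X X')) gX'
          (kunnethProjector X' eX' eX'X' hX'0 hgX' hcX' hgX'X' t₂)) := by
  rw [integralHodgeClassesPushforward_swapHom_corrCross eXX eXX eX'X' eX'X' ePP ePP hG hcX hgXX hcX' hgX'X' hcP hgPP,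
    integralHodgeClassesPushforward_swapHom_kunnethProjector X eX eXX hX0 hgX hcX hgXX s s₂ hss,
    integralHodgeClassesPushforward_swapHom_kunnethProjector X' eX' eX'X' hX'0 hgX' hcX' hgX'X' t t₂ htt]

end Kunneth

end ComplexTorusCat

end Literature.AlgebraicGeometry.HodgeTheory
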